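import Literature.Analysis.FluidPDE.GCLMSelfSimilarAnsatz
import HarnessLib

/-!
# Huang–Qin–Wang–Wei 2024, Corollary 2.2 FROM Theorem 2.1 (kernel-checked): exactly self-similar
# finite-time blow-up of the inviscid gCLM on the line for every `a ∈ (0, a̲)`

HONEST FRAMING (cell ns-blowup GROUP B «PROFILE SEARCH», zone Z3): **1-D MODEL (gCLM/OSW), not Euler/NS.**

Analysis/FluidPDE PROOF file (NO named fact): the regularity side conditions of `GCLMSelfSimilarAnsatz.lean` are
discharged — `C¹ ∩ L¹` functions are `HilbertPVAdmissible`, and an odd continuous function with an algebraic tail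
`x^q Ω(x) → L`, `q > 1`, is integrable — so that the typed fact `huangQinWangWei2024_selfSimilarProfiles`
([HuangQinWangWei2024] Thm 2.1) IMPLIES, for every `a ∈ (0, a̲)` (`a̲ = 400/(848−9π²) ≈ 0.5269`) and every `T > 0`,
an exactly self-similar CLASSICAL solution `ω(t,x) = (T−t)⁻¹Ω(x/(T−t)^{c_l})` of the inviscid gCLM
`ω_t + a u ω_x = u_x ω`, `u_x = Hω` on `ℝ × [0,T)` (`IsGCLMLineSolution a 0 ω T`), from the smooth integrable odd
datum `x ↦ T⁻¹Ω(x/T^{c_l})`, whose sup norm blows up at `T` — the source's Corollary 2.2 ("For any `a ≤ a̲`, the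
generalized Constantin–Lax–Majda model can develop finite-time singularity from smooth initial data") on the
sub-range `0 < a < a̲` where the focusing profile (`0 < c_l < 1`, tail `|x|^{−1/c_l}`) is integrable (for `a ≤ 0`
the printed profile has `c_l ≥ 1` and is not in `L¹`; our classical-solution class asks `L¹` slices).

* `hilbertPVAdmissible_of_contDiff` — `f ∈ C¹ ∩ L¹ ⇒ HilbertPVAdmissible f` (near piece: mean-value bound on a
  compact interval; far piece: dominated by `r⁻¹|f(y−w)|`).
* `integrable_of_odd_of_tendsto_rpow_mul` — odd, continuous, `x^q·Ω(x) → L` at `+∞` with `q > 1` ⇒ `Ω ∈ L¹`.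
* `isGCLMLineSolution_gclmSelfSimilar_of_contDiff` — the ansatz theorem with the admissibility discharged.
* `huangQinWangWei2024_selfSimilarProfiles.exact_selfSimilar_blowup` — the corollary above.

## References

* D. Huang, X. Qin, X. Wang, D. Wei, Arch. Ration. Mech. Anal. 248 (2024) 22 = arXiv:2305.05895, Thm 2.1,
  Cor. 2.2. [HuangQinWangWei2024]
-/

noncomputable section

open _root_.MeasureTheory Set Filter Metric
open scoped Real Topology

namespace Literature.Analysis.FluidPDE

/-! ### `C¹ ∩ L¹` functions are admissible -/

/-- The near integrand of a `C¹` function is bounded on `(−r, r)`: `|(f(y−w) − f(y))/w| ≤ K` where `K` bounds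
`|f′|` on `[y−r, y+r]` (mean value inequality). [cite: HuangQinWangWei2024, eq. (2.2)] -/
theorem abs_near_integrand_le_of_deriv_bound {f : ℝ → ℝ} (hf : Differentiable ℝ f) {y r K : ℝ}
    (hK : ∀ z ∈ Icc (y - r) (y + r), ‖deriv f z‖ ≤ K) {w : ℝ} (hw : w ∈ Ioo (-r) r) :
    |(f (y - w) - f y) / w| ≤ K := by
  by_cases hw0 : w = 0
  · subst hw0
    have hK0 : 0 ≤ K := (norm_nonneg _).trans (hK y ⟨by linarith [hw.2], by linarith [hw.2]⟩)
    simpa using hK0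
  have hconv : Convex ℝ (Icc (y - r) (y + r)) := convex_Icc _ _
  have hy : y ∈ Icc (y - r) (y + r) := ⟨by linarith [hw.1, hw.2], by linarith [hw.1, hw.2]⟩
  have hyw : y - w ∈ Icc (y - r) (y + r) := ⟨by linarith [hw.2], by linarith [hw.1]⟩
  have hmv := hconv.norm_image_sub_le_of_norm_deriv_le (fun z _ => hf.differentiableAt) hK hy hyw
  rw [abs_div, div_le_iff₀ (abs_pos.2 hw0)]
  have h1 : ‖f (y - w) - f y‖ ≤ K * ‖y - w - y‖ := hmv
  rw [show y - w - y = -w by ring, norm_neg, Real.norm_eq_abs, Real.norm_eq_abs] at h1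
  exact h1

/-- **`C¹ ∩ L¹ ⇒ HilbertPVAdmissible`**: for a continuously differentiable integrable `f` both pieces of the
split principal value are integrable at every base point and radius. [cite: HuangQinWangWei2024, eq. (2.2)] -/
theorem hilbertPVAdmissible_of_contDiff {f : ℝ → ℝ} (hf : ContDiff ℝ 1 f) (hfi : Integrable f) :
    HilbertPVAdmissible f := by
  have hfd : Differentiable ℝ f := hf.differentiable one_ne_zero
  have hfc : Continuous f := hf.continuous
  have hf'c : Continuous (deriv f) := hf.continuous_deriv le_rfl
  refine ⟨fun y r hr => ?_, fun y r hr => ?_⟩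
  · -- near piece: bounded by the sup of |f'| on [y - r, y + r]
    obtain ⟨K, hK⟩ := (isCompact_Icc : IsCompact (Icc (y - r) (y + r))).exists_bound_of_continuousOn
      hf'c.continuousOn
    refine Measure.integrableOn_of_bounded (M := K) measure_Ioo_lt_top.ne
      ((((hfc.comp (continuous_sub_left y)).sub continuous_const).measurable.div
        measurable_id).aestronglyMeasurable) ?_
    exact (ae_restrict_iff' measurableSet_Ioo).2 (ae_of_all _ fun w hw => by
      rw [Real.norm_eq_abs]; exact abs_near_integrand_le_of_deriv_bound hfd hK hw)
  · -- far piece: dominated by r⁻¹ |f(y - w)|, and w ↦ f(y - w) is integrable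
    have hint : Integrable (fun w => f (y - w)) := hfi.comp_sub_left y
    have hmeas : AEStronglyMeasurable (fun w => f (y - w) / w)
        (volume.restrict {w : ℝ | r ≤ |w|}) :=
      ((hfc.comp (continuous_sub_left y)).measurable.div measurable_id).aestronglyMeasurable
    refine Integrable.mono' ((hint.norm.const_mul r⁻¹).integrableOn) hmeas ?_
    refine (ae_restrict_iff' (Literature.Analysis.Fourier.measurableSet_le_abs r)).2
      (ae_of_all _ fun w hw => ?_)
    have hw0 : 0 < |w| := hr.trans_le hw
    rw [Real.norm_eq_abs, abs_div, Real.norm_eq_abs, div_eq_mul_inv, mul_comm]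
    refine mul_le_mul_of_nonneg_right ?_ (abs_nonneg _)
    exact inv_anti₀ hr hw

/-! ### Odd functions with an algebraic tail of order `> 1` are integrable -/

/-- An odd continuous `Ω` with `x^q·Ω(x) → L` as `x → +∞` for some `q > 1` is integrable on `ℝ` (tails
`|Ω(x)| ≤ (|L|+1)|x|^{−q}` beyond some `R ≥ 1`, continuity on `[−R, R]`, oddness for the left tail). The case of
[cite: HuangQinWangWei2024, Thm 2.1 (case (3): `x^{1/c_l}ω(x) → −C_a`)] with `0 < c_l < 1`. -/
theorem integrable_of_odd_of_tendsto_rpow_mul {Ω : ℝ → ℝ} (hc : Continuous Ω) (hodd : Function.Odd Ω)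
    {q L : ℝ} (hq : 1 < q) (hlim : Tendsto (fun x => x ^ q * Ω x) atTop (𝓝 L)) : Integrable Ω := by
  -- eventual tail bound
  have hev : ∀ᶠ x in atTop, dist (x ^ q * Ω x) L < 1 := hlim.eventually (Metric.ball_mem_nhds L one_pos)
  obtain ⟨R₁, hR₁⟩ := Filter.eventually_atTop.1 hev
  set R : ℝ := max R₁ 1 with hRdef
  have hR1 : 1 ≤ R := le_max_right _ _
  have hRpos : 0 < R := one_pos.trans_le hR1
  have htail : ∀ x, R ≤ x → |Ω x| ≤ (|L| + 1) * x ^ (-q) := by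
    intro x hx
    have hxpos : 0 < x := hRpos.trans_le hx
    have hxq : 0 < x ^ q := Real.rpow_pos_of_pos hxpos q
    have h1 : |x ^ q * Ω x - L| < 1 := by
      have := hR₁ x ((le_max_left _ _).trans hx)
      rwa [Real.dist_eq] at this
    have h2 : |x ^ q * Ω x| ≤ |L| + 1 := by
      have := abs_sub_abs_le_abs_sub (x ^ q * Ω x) L
      linarith
    rw [abs_mul, abs_of_pos hxq] at h2
    rw [Real.rpow_neg hxpos.le, ← div_eq_mul_inv, le_div_iff₀ hxq]
    linarith [mul_comm (x ^ q) (|Ω x|)]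
  -- the three pieces
  have hmid : IntegrableOn Ω (Icc (-R) R) := hc.continuousOn.integrableOn_compact isCompact_Icc
  have hright : IntegrableOn Ω (Ioi R) := by
    have hg : IntegrableOn (fun x : ℝ => (|L| + 1) * x ^ (-q)) (Ioi R) :=
      ((integrableOn_Ioi_rpow_of_lt (by linarith : -q < -1) hRpos).const_mul _)
    refine Integrable.mono' hg hc.aestronglyMeasurable ?_
    exact (ae_restrict_iff' measurableSet_Ioi).2 (ae_of_all _ fun x hx => by
      rw [Real.norm_eq_abs]; exact htail x (le_of_lt hx))
  have hleft : IntegrableOn Ω (Iio (-R)) := by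
    -- reflect the right tail: Ω(-x) = -Ω(x)
    have hpre : (fun x : ℝ => -x) ⁻¹' (Iio (-R)) = Ioi R := by
      ext x; simp
    have key : IntegrableOn (Ω ∘ fun x : ℝ => -x) ((fun x : ℝ => -x) ⁻¹' Iio (-R)) ↔
        IntegrableOn Ω (Iio (-R)) :=
      (Measure.measurePreserving_neg (volume : Measure ℝ)).integrableOn_comp_preimage
        (Homeomorph.neg ℝ).measurableEmbedding
    rw [hpre] at key
    refine key.1 ?_
    have : (Ω ∘ fun x : ℝ => -x) = fun x => -Ω x := by
      funext x; simp [Function.comp, hodd x]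
    rw [this]
    exact hright.neg
  have hunion : IntegrableOn Ω (Iio (-R) ∪ Icc (-R) R ∪ Ioi R) := (hleft.union hmid).union hright
  have hcover : Iio (-R) ∪ Icc (-R) R ∪ Ioi R = univ := by
    ext x
    simp only [mem_union, mem_Iio, mem_Icc, mem_Ioi, mem_univ, iff_true]
    rcases lt_or_ge x (-R) with h | h
    · exact Or.inl (Or.inl h)
    · rcases le_or_gt x R with h' | h'
      · exact Or.inl (Or.inr ⟨h, h'⟩)
      · exact Or.inr h'
  rw [hcover, integrableOn_univ] at hunion
  exact hunion

/-! ### The ansatz theorem with the side condition discharged, and HQWW Cor 2.2 from Thm 2.1 -/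

/-- `isGCLMLineSolution_gclmSelfSimilar` for `C² ∩ L¹` profiles, admissibility discharged: if `Ω ∈ C² ∩ L¹`
solves `(c_l X + aU)Ω′ = (−1 + HΩ)Ω` everywhere then `ω(t,x) = (T−t)⁻¹Ω(x/(T−t)^{c_l})` is a classical inviscid
gCLM solution on `ℝ × [0,T)` for every `T > 0`. [cite: HuangQinWangWei2024, §2 and Cor. 2.2] -/
theorem isGCLMLineSolution_gclmSelfSimilar_of_contDiff {a cl T : ℝ} {Ω : ℝ → ℝ} (hT : 0 < T)
    (hΩ2 : ContDiff ℝ 2 Ω) (hΩi : Integrable Ω) (hP : ∀ X : ℝ, GCLMProfileEqAt a cl (-1) Ω X) :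
    IsGCLMLineSolution a 0 (gclmSelfSimilar (-1) cl T Ω) T :=
  isGCLMLineSolution_gclmSelfSimilar hT hΩ2 hΩi
    (hilbertPVAdmissible_of_contDiff (hΩ2.of_le (by norm_num)) hΩi) hP

/-- **Huang–Qin–Wang–Wei 2024, Corollary 2.2 on `0 < a < a̲`, FROM the typed Theorem 2.1**: under the fact
`huangQinWangWei2024_selfSimilarProfiles`, for every `a ∈ (0, a̲)` and every `T > 0` there are a smooth odd
integrable profile `Ω` (strictly negative on `(0,∞)`) and an exponent `c_l ∈ (0, 1)` solving the profile
equation everywhere, such that the exactly self-similar ansatz `ω(t,x) = (T−t)⁻¹Ω(x/(T−t)^{c_l})` is a CLASSICAL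
solution of the inviscid gCLM on `ℝ × [0,T)` whose sup norm blows up at `T` — finite-time blow-up from the smooth
`L¹` datum `x ↦ T⁻¹Ω(x/T^{c_l})`. (Source, Cor. 2.2: "For any `a ≤ a̲ ≈ 0.5269`, the generalized
Constantin–Lax–Majda model can develop finite-time singularity from smooth initial data"; here the sub-range
`0 < a < a̲`, where the printed focusing profile has `c_l ∈ (0,1)` and hence an integrable `|x|^{−1/c_l}` tail.)
Honest framing: 1-D MODEL, not Euler/NS. [cite: HuangQinWangWei2024, Cor. 2.2] -/
theorem huangQinWangWei2024_selfSimilarProfiles.exact_selfSimilar_blowup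
    (h : huangQinWangWei2024_selfSimilarProfiles) {a : ℝ} (ha0 : 0 < a) (ha : a < hqwwLower)
    {T : ℝ} (hT : 0 < T) :
    ∃ (Ω : ℝ → ℝ) (cl : ℝ), 0 < cl ∧ cl < 1 ∧ ContDiff ℝ (⊤ : ℕ∞) Ω ∧ Function.Odd Ω ∧ Integrable Ω ∧
      (∀ x : ℝ, 0 < x → Ω x < 0) ∧ (∀ X : ℝ, GCLMProfileEqAt a cl (-1) Ω X) ∧
      IsGCLMLineSolution a 0 (gclmSelfSimilar (-1) cl T Ω) T ∧
      SupNormBlowupBefore (gclmSelfSimilar (-1) cl T Ω) T := by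
  obtain ⟨Cbar, Ctil, Chat, -, -, -, hall⟩ := h
  have ha1 : a < 1 := ha.trans hqwwLower_lt_hqwwUpper.2.1 |>.trans hqwwLower_lt_hqwwUpper.2.2
  obtain ⟨Ω, cl, μ, hodd, -, -, -, -, -, hμ0, hμ1, -, hform, -, hlow, htype⟩ := hall a ha1.le
  have hcl : 0 < cl := hlow ha
  have hcl1 : cl < 1 := (huangQinWangWei2024_selfSimilarProfiles.cl_formula_mem_Ioo ha0 ha1 hμ0 hμ1 hform).2
  rcases htype with ⟨hneg, -⟩ | ⟨hzero, -⟩ | ⟨-, hsign, hsmooth, -, heq, C, -, hlim⟩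
  · exact absurd hneg (not_lt.2 hcl.le)
  · exact absurd hzero hcl.ne'
  · have hcont : Continuous Ω := hsmooth.continuous
    have hq : 1 < 1 / cl := by rw [lt_div_iff₀ hcl]; linarith
    have hint : Integrable Ω := integrable_of_odd_of_tendsto_rpow_mul hcont hodd hq hlim
    have h2 : ContDiff ℝ 2 Ω := hsmooth.of_le (by norm_cast)
    have hsol := isGCLMLineSolution_gclmSelfSimilar_of_contDiff (T := T) hT h2 hint heq
    have hX₀ : Ω 1 ≠ 0 := (hsign 1 one_pos).ne
    exact ⟨Ω, cl, hcl, hcl1, hsmooth, hodd, hint, hsign, heq, hsol,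
      supNormBlowupBefore_gclmSelfSimilar hT hX₀⟩

end Literature.Analysis.FluidPDE
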